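/-
Copyright: statement-level skeleton of a published paper (lit-balaban cell, Phase-2 proof seat p10, gen 5). No proof claims
beyond what the kernel checks below.
-/
import Mathlib
import Literature.MathematicalPhysics.QuantumFieldTheory.BalabanImbrieJaffe1984to88.BIJ85FibreCurlIntertwine

/-!
# `BalabanImbrieJaffe1984to88.BIJ85FibreOffCentre` — T. Bałaban, J. Imbrie, A. Jaffe, *Renormalization of the Higgs model:
minimizers, propagators and the stability of mean field theory*, Commun. Math. Phys. **97** (1985) 299–329
[BalabanImbrieJaffe1985]: Sect. 7.1 pp. 322–325 — **the elementary momentum-space bounds of the proof of Theorem 7.1.1 for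
EVERY block size n = L^k** (even L included), over the complete residue system of offsets k : Fin d → Fin n: Δ(p′+l) ≥ 4 off the
centre and Δ(p′) > 0, ≤ dπ² at the centre; (7.1.20) `|v_μ(p′)| ≥ 2/π`, hence `|w_{μν}(p′)|² ≥ (4/π²)^d`; the [6I]-type sandwich
`(4/π²)^{d+2} ≤ Δ^{(1)}(p′)φ_ν(p′) ≤ 1` for the φ_ν of **(7.1.10)** and `φ_ν(p′) ≥ (4/π²)^{d+1}/(dπ²)` — file 3a of seat p10 gen 5's
all-n chain (`BIJ85FibreDuality`/`BIJ85FibreDualBound` → `BIJ85FibreCurlIntertwine` → this/`BIJ85FibreCrossTerms` → `BIJ85Thm711AllL`);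
the off-centre averaging sum and the cross-term bound on A_ν(f^⊥) are in the sibling `BIJ85FibreCrossTerms`

statement-level skeleton of published theorems with citation tags; proofs where landed; nothing here is a claim about
the Yang–Mills mass gap

PDF held: `paper:balaban1985-cmp97-bij-higgs-minimizers` (journal page = PDF page + 298).  Renders read as images: PDF pp.
24–27 (journal 322–325), `run/shared/lean/pub/pub-balaban/t4/b2b-balaban-t4-lit2/renders/bij1985/…-p024…p027-x2.png`.

CITATION HEADER (lean-in-tree rule).  Part of the lit-balaban TYPED SKELETON (HOME `run/shared/lean/pub/lit-balaban/`); WHAT IS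
REPRODUCED: the estimates of SKELETON rows **C1.Prop7.1.2** ((7.1.20)) and **C1.Eq7.1.28-7.1.31** (p. 325 *"which is bounded below
by ε‖∂B‖² (see also [6I, 8])"*) in the service of **C1.Thm7.1.1** for all n (`HOME/lit-balaban-r15/ROWS-C1.md`, fold owner r15,
referee ref-5).  THE PRINTED TEXT (p. 323 [PDF 25]): *"In fact |v_μ(p)| = [sin(p_μ/2)/(p_μ/2)][(p_μη/2)/sin(p_μη/2)] from which it
follows that for |p_i| ≤ π, 2/π ≤ |v_μ(p)| ≤ π/2. (7.1.20)"*.  All leaves are pub-balaban's [6I]/B4 tree lemmas for GENERAL n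
(`B5Prop11Leaves`: `Sxir_le_S1r`, `DeltaXir_shift_ge_four`, `DeltaXir_pos`; `B4Strip`: `uFactorr_zero_ge`, `Sxir_le`,
`four_div_pi_sq_le_one`; `B5Prop11Fiber`: `norm_vSym_sq`, `norm_uSym_sq`, `norm_vSym_le_one`, `norm_d1Sym_sq_le`; p27's `norm_edgeW`).
WHAT IS KERNEL-CHECKED (zero `sorry`, standard axioms), every n ≥ 1, every torus, every unit momentum p′ = sOf q:
 §1 `lapK_eq_DeltaXir`, `four_le_lapK` (l ≠ 0), `lapK_zero_pos` (p′ ≠ 0), `lapK_ne_zero`, `epsSq` = Δ^{(1)}(p′) with `epsSq_le_lapK`,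
    `lapK_zero_le_epsSq` (Δ(p′) ≤ (π²/4)Δ^{(1)}(p′)), `lapK_zero_le` (≤ dπ²), `epsSq_pos`;
 §2 (7.1.20)-type: `norm_vSym_zero_sq_ge` (4/π² ≤ |v_ρ(p′)|²), `norm_uSym_zero_sq_ge`, **`norm_srcK_zero_sq_ge`** ((4/π²)^d|φ_{μν}|² ≤
    |w̄_{μν}(p′)φ_{μν}|² for antisymmetric φ);
 §3 **`phiK_sandwich`** ((4/π²)^{d+2} ≤ Δ^{(1)}φ_ν ≤ 1), `phiMin`, **`phiMin_le_phiK`**, `phiK_pos`.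
NOT CLAIMED here: the off-centre sum / cross terms (`BIJ85FibreCrossTerms`) and the assembly (file 4).  Unit `lit-balaban-p10`
(gen 5), HOME as above.
-/

namespace Literature.MathematicalPhysics.QuantumFieldTheory.BalabanImbrieJaffe1984to88.BIJ85FibreOffCentre

open scoped BigOperators ComplexConjugate
open Complex Finset
open Literature.MathematicalPhysics.QuantumFieldTheory.Balaban1983to89
open Literature.MathematicalPhysics.QuantumFieldTheory.Balaban1983to89.B4Strip
open Literature.MathematicalPhysics.QuantumFieldTheory.Balaban1983to89.B5Prop11Plancherel
open Literature.MathematicalPhysics.QuantumFieldTheory.Balaban1983to89.B5Prop11Fiber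
open Literature.MathematicalPhysics.QuantumFieldTheory.Balaban1983to89.B5Prop11Leaves
open Literature.MathematicalPhysics.QuantumFieldTheory.Balaban1983to89.B5Block118
open Literature.MathematicalPhysics.QuantumFieldTheory.BalabanImbrieJaffe1984to88.BIJ85Eq7111EdgeAverage
open Literature.MathematicalPhysics.QuantumFieldTheory.BalabanImbrieJaffe1984to88.BIJ85Eq7112FibreEnergy
open Literature.MathematicalPhysics.QuantumFieldTheory.BalabanImbrieJaffe1984to88.BIJ85FibreDuality
open Literature.MathematicalPhysics.QuantumFieldTheory.BalabanImbrieJaffe1984to88.BIJ85FibreCurlIntertwine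

noncomputable section

variable {d : ℕ} (n : ℕ) [NeZero n] (M : Fin d → ℕ) [hM : ∀ μ, NeZero (M μ)]

/-! ## §1 Δ(p′+l): at least 4 off the centre, positive and at most dπ² at the centre -/

omit [NeZero n] hM in
/-- Δ(p′+l) is pub-balaban's `DeltaXir n 0` at the shifted momentum. [cite: BalabanImbrieJaffe1985, (7.1.6) p.322] -/
theorem lapK_eq_DeltaXir (q : Tor M) (k : Fin d → Fin n) : lapK n M q k = DeltaXir n 0 (shiftr n k (sOf M q)) := by
  rw [lapK, Delta_eq]

/-- |p′_μ| ≤ π on the torus. [cite: BalabanImbrieJaffe1985, (7.1.8) p.322] -/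
theorem abs_sOf_le' (q : Tor M) : ∀ μ, |sOf M q μ| ≤ Real.pi := fun μ => abs_sOf_le M q μ

/-- **Δ(p′+l) ≥ 4 for l ≠ 0** (some |p′_ρ + l_ρ| ∈ [π, π(2n−1)]; [6I] leaf `DeltaXir_shift_ge_four`), every n.
[cite: BalabanImbrieJaffe1985, (7.1.23) p.324] -/
theorem four_le_lapK (q : Tor M) {k : Fin d → Fin n} (hk : k ≠ 0) : 4 ≤ lapK n M q k := by
  rw [lapK_eq_DeltaXir]
  exact DeltaXir_shift_ge_four n k (fun h => hk (by rw [h]; rfl)) (sOf M q) (abs_sOf_le' M q)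

/-- Δ(p′) > 0 for p′ ≠ 0 (q ≠ 0 on the torus). [cite: BalabanImbrieJaffe1985, (7.1.6) p.322] -/
theorem lapK_zero_pos {q : Tor M} (hq : q ≠ 0) : 0 < lapK n M q 0 := by
  obtain ⟨μ, hμ⟩ := Function.ne_iff.mp (sOf_ne_zero M hq)
  rw [lapK_eq_DeltaXir, show shiftr n (0 : Fin d → Fin n) (sOf M q) = sOf M q from shiftr_zero n (sOf M q)]
  exact DeltaXir_pos n NeZero.one_le (sOf M q) (abs_sOf_le' M q) μ hμ

/-- No Δ(p′+l) vanishes when p′ ≠ 0. [cite: BalabanImbrieJaffe1985, (7.1.6) p.322] -/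
theorem lapK_ne_zero {q : Tor M} (hq : q ≠ 0) (k : Fin d → Fin n) : lapK n M q k ≠ 0 := by
  by_cases hk : k = 0
  · subst hk
    exact (lapK_zero_pos n M hq).ne'
  · have := four_le_lapK n M q hk
    linarith

omit [NeZero n] hM in
/-- Δ^{(1)}(p′) = Σ_μ |∂^{(1)}_μ(p′)|² (7.1.6), unit lattice. [cite: BalabanImbrieJaffe1985, (7.1.6) p.322] -/
def epsSq (q : Tor M) : ℝ := ∑ μ, ‖d1Sym (sOf M q) μ‖ ^ 2

omit hM in
/-- Δ^{(1)}(p′) ≤ Δ(p′+l) at every offset (|∂^{(1)}_μ| ≤ |∂_μ|, [6I] leaf). [cite: BalabanImbrieJaffe1985, (7.1.23) p.324] -/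
theorem epsSq_le_lapK (q : Tor M) (k : Fin d → Fin n) : epsSq M q ≤ lapK n M q k :=
  Finset.sum_le_sum fun μ _ => norm_d1Sym_sq_le n NeZero.one_le k (sOf M q) μ

/-- Δ(p′) ≤ (π²/4)Δ^{(1)}(p′) (Jordan, [6I] leaf `Sxir_le_S1r`). [cite: BalabanImbrieJaffe1985, (7.1.20) p.323] -/
theorem lapK_zero_le_epsSq (q : Tor M) : lapK n M q 0 ≤ Real.pi ^ 2 / 4 * epsSq M q := by
  rw [lapK, epsSq, Finset.mul_sum]
  refine Finset.sum_le_sum fun μ _ => ?_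
  rw [norm_dSym_sq, norm_d1Sym_sq, show shiftr n (0 : Fin d → Fin n) (sOf M q) μ = sOf M q μ by
    rw [show shiftr n (0 : Fin d → Fin n) (sOf M q) = sOf M q from shiftr_zero n (sOf M q)]]
  exact Sxir_le_S1r n (sOf M q μ) (abs_sOf_le' M q μ)

/-- Δ(p′) ≤ dπ² (|∂_μ(p′)|² ≤ p′_μ² ≤ π²). [cite: BalabanImbrieJaffe1985, (7.1.6) p.322] -/
theorem lapK_zero_le (q : Tor M) : lapK n M q 0 ≤ d * Real.pi ^ 2 := by
  have h : ∀ μ, ‖dSym n 0 (sOf M q) μ‖ ^ 2 ≤ Real.pi ^ 2 := by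
    intro μ
    rw [norm_dSym_sq, show shiftr n (0 : Fin d → Fin n) (sOf M q) μ = sOf M q μ by
      rw [show shiftr n (0 : Fin d → Fin n) (sOf M q) = sOf M q from shiftr_zero n (sOf M q)]]
    have h1 := Sxir_le n (sOf M q μ)
    have h2 : (sOf M q μ) ^ 2 ≤ Real.pi ^ 2 := by
      have := abs_sOf_le' M q μ
      rw [← sq_abs]
      exact pow_le_pow_left₀ (abs_nonneg _) this 2
    linarith
  calc lapK n M q 0 = ∑ μ, ‖dSym n 0 (sOf M q) μ‖ ^ 2 := rfl
    _ ≤ ∑ _μ : Fin d, Real.pi ^ 2 := Finset.sum_le_sum fun μ _ => h μ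
    _ = d * Real.pi ^ 2 := by rw [Finset.sum_const, Finset.card_univ, Fintype.card_fin, nsmul_eq_mul]

omit [NeZero n] in
/-- Δ^{(1)}(p′) > 0 for p′ ≠ 0. [cite: BalabanImbrieJaffe1985, (7.1.6) p.322] -/
theorem epsSq_pos {q : Tor M} (hq : q ≠ 0) : 0 < epsSq M q := by
  obtain ⟨μ, hμ⟩ := Function.ne_iff.mp (sOf_ne_zero M hq)
  rw [epsSq, ← Delta0_eq]
  exact Delta1r_pos (sOf M q) (abs_sOf_le' M q) μ hμ

/-! ## §2 (7.1.20): |v_μ(p′)| ≥ 2/π at the centre; the weight |w_{μν}(p′)| -/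

/-- **(7.1.20)**, lower half, squared: 4/π² ≤ |v_ρ(p′)|² for |p′_i| ≤ π ([6I] leaf `uFactorr_zero_ge`, removable point included).
[cite: BalabanImbrieJaffe1985, (7.1.20) p.323] -/
theorem norm_vSym_zero_sq_ge (q : Tor M) (ρ : Fin d) : 4 / Real.pi ^ 2 ≤ ‖vSym n 0 (sOf M q) ρ‖ ^ 2 := by
  rw [norm_vSym_sq n NeZero.one_le 0 (sOf M q) ρ (abs_sOf_le' M q ρ)]
  exact uFactorr_zero_ge n NeZero.one_le (sOf M q ρ) (abs_sOf_le' M q ρ)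

/-- |u(p′)|² ≥ (4/π²)^d. [cite: BalabanImbrieJaffe1985, (7.1.20) p.323] -/
theorem norm_uSym_zero_sq_ge (q : Tor M) : (4 / Real.pi ^ 2) ^ d ≤ ‖uSym n 0 (sOf M q)‖ ^ 2 := by
  rw [norm_uSym_sq n NeZero.one_le 0 (sOf M q) (abs_sOf_le' M q)]
  exact Ur_zero_ge n NeZero.one_le (sOf M q) (abs_sOf_le' M q)

/-- kernel: a product of |v_ρ(p′)|² over any set of directions is ≥ (4/π²)^d (each factor ∈ [4/π², 1]... ≥ 4/π², and 4/π² ≤ 1).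
[cite: BalabanImbrieJaffe1985, (7.1.20) p.323] -/
theorem prod_norm_vSym_zero_sq_ge (q : Tor M) (S : Finset (Fin d)) :
    (4 / Real.pi ^ 2) ^ d ≤ ∏ ρ ∈ S, ‖vSym n 0 (sOf M q) ρ‖ ^ 2 := by
  have h0 : (0 : ℝ) ≤ 4 / Real.pi ^ 2 := by positivity
  calc (4 / Real.pi ^ 2) ^ d ≤ (4 / Real.pi ^ 2) ^ S.card :=
        pow_le_pow_of_le_one h0 four_div_pi_sq_le_one (by simpa using Finset.card_le_univ S)
    _ = ∏ _ρ ∈ S, (4 / Real.pi ^ 2 : ℝ) := by rw [Finset.prod_const]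
    _ ≤ ∏ ρ ∈ S, ‖vSym n 0 (sOf M q) ρ‖ ^ 2 :=
        Finset.prod_le_prod (fun _ _ => h0) fun ρ _ => norm_vSym_zero_sq_ge n M q ρ

/-- **The central source dominates φ**: for an antisymmetric φ, (4/π²)^d|φ_{μν}|² ≤ |w̄_{μν}(p′)φ_{μν}|² (|w_{μν}(p′)| = Π_{ρ∉{μ,ν}}|v_ρ(p′)|
≥ (2/π)^{d−2} by (7.1.20); the diagonal vanishes on both sides). [cite: BalabanImbrieJaffe1985, (7.1.20) p.323] -/
theorem norm_srcK_zero_sq_ge (q : Tor M) {φ : Fin d × Fin d → ℂ} (hφ : ∀ μ ν, φ (ν, μ) = -φ (μ, ν)) (μ ν : Fin d) :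
    (4 / Real.pi ^ 2) ^ d * ‖φ (μ, ν)‖ ^ 2 ≤ ‖srcK n M q φ 0 μ ν‖ ^ 2 := by
  by_cases hμν : μ = ν
  · subst hμν
    have h0 : φ (μ, μ) = 0 := by
      have := hφ μ μ
      linear_combination (1 / 2 : ℂ) * this
    simp [srcK, h0]
  · rw [srcK, norm_mul, mul_pow, Complex.norm_conj, norm_edgeW n M 0 q hμν, ← Finset.prod_pow]
    exact mul_le_mul_of_nonneg_right (prod_norm_vSym_zero_sq_ge n M q _) (sq_nonneg _)

/-! ## §3 φ_ν(p′) of (7.1.10): the [6I]-type sandwich and a uniform lower bound -/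

/-- **(4/π²)^{d+2} ≤ Δ^{(1)}(p′)φ_ν(p′) ≤ 1** for p′ ≠ 0, every n: the lower bound from the l = 0 term with (7.1.20) and Δ(p′) ≤
(π²/4)Δ^{(1)}(p′); the upper bound from Δ^{(1)} ≤ Δ(p′+l), |v| ≤ 1 and Σ_l|u(p′+l)|² = 1 — the [6I] (1.85)-type sandwich the print
invokes on p. 325 *"(see also [6I, 8])"*. [cite: BalabanImbrieJaffe1985, (7.1.31) p.325] -/
theorem phiK_sandwich {q : Tor M} (hq : q ≠ 0) (ν : Fin d) :
    (4 / Real.pi ^ 2) ^ (d + 2) ≤ epsSq M q * phiK n M q ν ∧ epsSq M q * phiK n M q ν ≤ 1 := by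
  have hΔ0 := lapK_zero_pos n M hq
  have hε := epsSq_pos M hq
  constructor
  · -- the l = 0 term
    have hterm : ‖rK n M q 0 ν‖ ^ 2 / lapK n M q 0 ≤ phiK n M q ν := by
      rw [phiK]
      exact Finset.single_le_sum (f := fun k => ‖rK n M q k ν‖ ^ 2 / lapK n M q k)
        (fun k _ => div_nonneg (sq_nonneg _) (lapK_nonneg n M q k)) (Finset.mem_univ 0)
    have hr : (4 / Real.pi ^ 2) ^ (d + 1) ≤ ‖rK n M q 0 ν‖ ^ 2 := by
      rw [rK, norm_mul, mul_pow, pow_succ]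
      exact mul_le_mul (norm_uSym_zero_sq_ge n M q) (norm_vSym_zero_sq_ge n M q ν) (by positivity) (sq_nonneg _)
    have hratio : 4 / Real.pi ^ 2 ≤ epsSq M q / lapK n M q 0 := by
      rw [le_div_iff₀ hΔ0]
      have := lapK_zero_le_epsSq n M q
      have hπ : 0 < Real.pi ^ 2 := by positivity
      calc 4 / Real.pi ^ 2 * lapK n M q 0 ≤ 4 / Real.pi ^ 2 * (Real.pi ^ 2 / 4 * epsSq M q) :=
            mul_le_mul_of_nonneg_left this (by positivity)
        _ = epsSq M q := by field_simp
    calc (4 / Real.pi ^ 2) ^ (d + 2) = (4 / Real.pi ^ 2) ^ (d + 1) * (4 / Real.pi ^ 2) := pow_succ _ _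
      _ ≤ ‖rK n M q 0 ν‖ ^ 2 * (epsSq M q / lapK n M q 0) := mul_le_mul hr hratio (by positivity) (sq_nonneg _)
      _ = epsSq M q * (‖rK n M q 0 ν‖ ^ 2 / lapK n M q 0) := by ring
      _ ≤ epsSq M q * phiK n M q ν := mul_le_mul_of_nonneg_left hterm hε.le
  · rw [phiK, Finset.mul_sum]
    calc ∑ k, epsSq M q * (‖rK n M q k ν‖ ^ 2 / lapK n M q k) ≤ ∑ k, ‖uSym n k (sOf M q)‖ ^ 2 := by
          refine Finset.sum_le_sum fun k _ => ?_
          have hΔk : 0 < lapK n M q k := lt_of_le_of_ne (lapK_nonneg n M q k) (Ne.symm (lapK_ne_zero n M hq k))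
          have hv : ‖vSym n k (sOf M q) ν‖ ^ 2 ≤ 1 := by
            have := norm_vSym_le_one n NeZero.one_le k (sOf M q) ν
            nlinarith [norm_nonneg (vSym n k (sOf M q) ν)]
          have hεk : epsSq M q / lapK n M q k ≤ 1 := (div_le_one hΔk).mpr (epsSq_le_lapK n M q k)
          rw [rK, norm_mul, mul_pow]
          calc epsSq M q * (‖uSym n k (sOf M q)‖ ^ 2 * ‖vSym n k (sOf M q) ν‖ ^ 2 / lapK n M q k)
              = ‖uSym n k (sOf M q)‖ ^ 2 * ‖vSym n k (sOf M q) ν‖ ^ 2 * (epsSq M q / lapK n M q k) := by ring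
            _ ≤ ‖uSym n k (sOf M q)‖ ^ 2 * 1 * 1 :=
                mul_le_mul (mul_le_mul_of_nonneg_left hv (sq_nonneg _)) hεk (by positivity) (by positivity)
            _ = ‖uSym n k (sOf M q)‖ ^ 2 := by ring
      _ = 1 := sum_norm_uSym_sq n M q

omit [NeZero n] hM in
/-- The uniform lower bound of φ_ν: φ_min(d) = (4/π²)^{d+1}/(dπ²). [cite: BalabanImbrieJaffe1985, (7.1.10) p.322] -/
def phiMin (d : ℕ) : ℝ := (4 / Real.pi ^ 2) ^ (d + 1) / (d * Real.pi ^ 2)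

omit [NeZero n] hM in
/-- φ_min(d) > 0 for d ≥ 1. [cite: BalabanImbrieJaffe1985, (7.1.10) p.322] -/
theorem phiMin_pos (hd : 0 < d) : 0 < phiMin d := by
  unfold phiMin
  have : (0 : ℝ) < d := by exact_mod_cast hd
  positivity

/-- **φ_ν(p′) ≥ (4/π²)^{d+1}/(dπ²)** for p′ ≠ 0, every n (the l = 0 term with (7.1.20) and Δ(p′) ≤ dπ²).
[cite: BalabanImbrieJaffe1985, (7.1.10) p.322] -/
theorem phiMin_le_phiK (hd : 0 < d) {q : Tor M} (hq : q ≠ 0) (ν : Fin d) : phiMin d ≤ phiK n M q ν := by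
  have hΔ0 := lapK_zero_pos n M hq
  have hd' : (0 : ℝ) < d := by exact_mod_cast hd
  have hr : (4 / Real.pi ^ 2) ^ (d + 1) ≤ ‖rK n M q 0 ν‖ ^ 2 := by
    rw [rK, norm_mul, mul_pow, pow_succ]
    exact mul_le_mul (norm_uSym_zero_sq_ge n M q) (norm_vSym_zero_sq_ge n M q ν) (by positivity) (sq_nonneg _)
  calc phiMin d = (4 / Real.pi ^ 2) ^ (d + 1) / (d * Real.pi ^ 2) := rfl
    _ ≤ ‖rK n M q 0 ν‖ ^ 2 / lapK n M q 0 := div_le_div₀ (sq_nonneg _) hr hΔ0 (lapK_zero_le n M q)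
    _ ≤ phiK n M q ν := by
        rw [phiK]
        exact Finset.single_le_sum (f := fun k => ‖rK n M q k ν‖ ^ 2 / lapK n M q k)
          (fun k _ => div_nonneg (sq_nonneg _) (lapK_nonneg n M q k)) (Finset.mem_univ 0)

/-- φ_ν(p′) > 0 for p′ ≠ 0 (d ≥ 1). [cite: BalabanImbrieJaffe1985, (7.1.10) p.322] -/
theorem phiK_pos (hd : 0 < d) {q : Tor M} (hq : q ≠ 0) (ν : Fin d) : 0 < phiK n M q ν :=
  lt_of_lt_of_le (phiMin_pos hd) (phiMin_le_phiK n M hd hq ν)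

end

end Literature.MathematicalPhysics.QuantumFieldTheory.BalabanImbrieJaffe1984to88.BIJ85FibreOffCentre
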